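import Mathlib
import HarnessLib.Audit
import Summits.PneNP.PneNP.Theorems.PstarHalfFreeGate

/-!
# Locality of exact-menu certificates: every monomial of the second reader touches the path-sum side (ROUND-24, O1; memo g26 §57)

FRONTIER range-avoidance ladder, rung F-N3, ROUND 24 (cell `pnp-ideate`, prover-2 memo `g26/O1-LOCALITY-g26.md` §57; typed targets
`PstarCoreBoundTargets.TerminalFive` / `TerminalPeelable` (p646951); census node `PstarMenuCriterion.MenuCriterionBound`; restricted-model
proof complexity — nothing here bears on `P` versus `NP`).

The planner's exact-menu model (p3 memo `r24/CORE-BOUND-NOTES.md` §14.65) runs on two bookkeeping rules, LOCALITY (L1: a certifying menu lives on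
the variables of its certificate) and POLLUTION (L2: a menu monomial far from the certificate disables the menu).  This file proves the form of
them that is TRUE FOR ALL `k`, for an arbitrary terminal pair `(K; Γ₁, Γ₂)` (`PstarCoreBoundTargets.Terminal`):

* `bit_gval_update` — the general FLIP FORMULA: changing `x_v` moves `gval C G` by `(new ⊕ old)·([v ∈ C] + starSum G v x)`, where
  `starSum G v x = Σ_{g ∈ G, p_g = v} x_{q_g} + Σ_{g ∈ G, q_g = v} x_{p_g}` is the PARTNER SUM of `v` in `G` (any number of monomials through `v`);
* `exists_sol_on_target₁/₂` — NON-DEGENERACY: the slice `A = Sol(K) ∩ {Γ₁ = b₁}` of a terminal pair is non-empty (`gSat` + (M0));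
* **`starSum_pinned`** — the POISON RULE for a FOREIGN variable `v` (in no output of `K`, not in `C₁`, in no monomial of `Γ₁`; any number of
  monomials of `Γ₂` through it): on `A`, `[v ∈ C₂] + starSum G₂ v ≡ 0` ((T3) at `x` and at `x` with `x_v` flipped).  With one monomial through `v`
  this is `PstarHalfFreeGate.sigma_eq_of_halfFree`;
* **`false_of_far_monomial`** — LOCALITY: no monomial `g ∈ G₂` has BOTH AND variables foreign to the `Γ₁`-side (flip the partner: it keeps `A`
  and moves the pinned partner sum by one — the AND pair `{v, w}` occurs once in `G₂` under simple overlaps).  This supersedes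
  `PstarFreeMonomial.false_of_free_monomial`: no hypothesis on the OTHER monomials through `v, w`, linear reads by `Γ₂` allowed;
* **`touches_pathSum_side`** — the census form for the certificates `(K₀; d₁, d₂)` of `MenuCriterionBound` (branch (A): `d₁` the path sum, its
  linear part read by `K₀`, monomials `F₁`; `d₂` with monomials `G ∪ F₂`): EVERY monomial of `d₂` — menu gate or fold — has an AND variable in
  `T(K₀)` or in an AND slot of a fold of `F₁`.  For an internal gate `(s, π_d)` on the private `π_d` of a dirty chord `d ∉ K₀ ∪ F₁` this says
  `s ∈ T(K₀) ∪ ANDvars(F₁)`; for a `σσ′` monomial one of the two σ-blocks meets `K₀ ∪ F₁`.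

WHAT IS NOT A THEOREM (memo §57.4, for the census): the two-sided model rule "vars(M) ⊆ T(V)" and the strong pollution rule "a pure connector
disables the two menus containing it".  A gate `(s, π_d)` with `π_d` fresh and `s` CONSTANT on `A` is admissible in an exact certificate (the
second reader absorbs it as `(s ⊕ [π_d ∈ C₂])·π_d ≡ 0` on `A`, and `π_d := 0` repairs every (M0) witness); `starSum_pinned` is exactly the
admissibility condition, and `false_of_far_monomial` the part of it that is combinatorial.
-/

set_option linter.dupNamespace false -- `Summit.PneNP.PneNP.…`: summit = sub-problem name (D-0017 single-conjunct layout)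

open Finset Literature.Computability.Complexity
open Summit.PneNP.PneNP.Theorems.PstarFibrePolys (bit bit_xor bit_injective)
open Summit.PneNP.PneNP.Theorems.PstarTyped (Typed)
open Summit.PneNP.PneNP.Theorems.PstarSALevel (varSet bdry BoundaryExpanding SimpleOverlap)
open Summit.PneNP.PneNP.Theorems.PstarCentreFree (vars_mem_varSet)
open Summit.PneNP.PneNP.Theorems.PstarGapPeeling (feasible_of_boundaryExpanding)
open Summit.PneNP.PneNP.Theorems.PstarGapOneAll (gval)
open Summit.PneNP.PneNP.Theorems.PstarGConstraint (bit_gval gval_update_of_forall_ne)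
open Summit.PneNP.PneNP.Theorems.PstarGSat (gSat)
open Summit.PneNP.PneNP.Theorems.PstarCoreBoundTargets (Terminal)
open Summit.PneNP.PneNP.Theorems.PstarChordReadSwitch (solves_update_of_outside)
open Summit.PneNP.PneNP.Theorems.PstarChordReadsMirror (terminal_swap)

namespace Summit.PneNP.PneNP.Theorems.PstarMenuLocality

variable {n m : ℕ}

/-! ## The flip formula -/
section Flip

variable (I : LocalMap 4 n m)

/-- In `𝔽₂`, `bit (!a) + bit a = 1`. -/
private theorem bit_not_add (a : Bool) : bit (!a) + bit a = 1 := by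
  cases a <;> decide

/-- The **PARTNER SUM** of the variable `v` in the monomial set `G` at the point `z`:
`Σ_{g ∈ G, p_g = v} z_{q_g} + Σ_{g ∈ G, q_g = v} z_{p_g}` (in `𝔽₂`). -/
def starSum (G : Finset (Fin m)) (v : Fin n) (z : Fin n → Bool) : ZMod 2 :=
  ∑ g ∈ G, ((if I.vars g 2 = v then bit (z (I.vars g 3)) else 0) + (if I.vars g 3 = v then bit (z (I.vars g 2)) else 0))

/-- One monomial under an update of `v`: `p·q` moves by `(new + old)·(its partner-sum term)`. -/
private theorem bit_mono_update (hI : I.IsPure xorAndPred) (g : Fin m) (z : Fin n → Bool) (v : Fin n) (b : Bool) :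
    bit (Function.update z v b (I.vars g 2)) * bit (Function.update z v b (I.vars g 3)) =
      bit (z (I.vars g 2)) * bit (z (I.vars g 3)) +
        (bit b + bit (z v)) * ((if I.vars g 2 = v then bit (z (I.vars g 3)) else 0) + (if I.vars g 3 = v then bit (z (I.vars g 2)) else 0)) := by
  have hpq : I.vars g 2 ≠ I.vars g 3 := fun e => absurd (hI.2 g e) (by decide)
  have h2 : ∀ x : ZMod 2, x + x = 0 := by decide
  by_cases hp : I.vars g 2 = v
  · have hq : I.vars g 3 ≠ v := fun h => hpq (hp.trans h.symm)
    rw [hp, Function.update_self, Function.update_of_ne hq, if_pos rfl, if_neg hq]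
    linear_combination (-(bit (z (I.vars g 3)))) * h2 (bit (z v))
  · by_cases hq : I.vars g 3 = v
    · rw [hq, Function.update_self, Function.update_of_ne hp, if_neg hp, if_pos rfl]
      linear_combination (-(bit (z (I.vars g 2)))) * h2 (bit (z v))
    · rw [Function.update_of_ne hp, Function.update_of_ne hq, if_neg hp, if_neg hq]
      ring

/-- **THE FLIP FORMULA.**  Updating `x_v` to `b` moves `gval C G` by `(bit b + bit x_v)·([v ∈ C] + starSum G v x)`. -/
theorem bit_gval_update (hI : I.IsPure xorAndPred) (C : Finset (Fin n)) (G : Finset (Fin m)) (z : Fin n → Bool) (v : Fin n) (b : Bool) :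
    bit (gval I C G (Function.update z v b)) =
      bit (gval I C G z) + (bit b + bit (z v)) * ((if v ∈ C then 1 else 0) + starSum I G v z) := by
  classical
  rw [bit_gval, bit_gval]
  have hC : ∑ w ∈ C, bit (Function.update z v b w) = ∑ w ∈ C, bit (z w) + (bit b + bit (z v)) * (if v ∈ C then 1 else 0) := by
    have key : ∀ w ∈ C, bit (Function.update z v b w) = bit (z w) + if w = v then bit b + bit (z v) else 0 := by
      intro w _
      by_cases h : w = v
      · subst h
        rw [Function.update_self, if_pos rfl]
        have h2 : ∀ x : ZMod 2, x + x = 0 := by decide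
        linear_combination (-1 : ZMod 2) * h2 (bit (z w))
      · rw [Function.update_of_ne h, if_neg h, add_zero]
    rw [sum_congr rfl key, sum_add_distrib, sum_ite_eq']
    split_ifs <;> ring
  have hG : ∑ g ∈ G, bit (Function.update z v b (I.vars g 2)) * bit (Function.update z v b (I.vars g 3)) =
      ∑ g ∈ G, bit (z (I.vars g 2)) * bit (z (I.vars g 3)) + (bit b + bit (z v)) * starSum I G v z := by
    unfold starSum
    rw [mul_sum, ← sum_add_distrib]
    exact sum_congr rfl fun g _ => bit_mono_update I hI g z v b
  rw [hC, hG]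
  ring

/-- Flipping `x_v`: `gval` moves by `[v ∈ C] + starSum G v x`. -/
theorem bit_gval_flip (hI : I.IsPure xorAndPred) (C : Finset (Fin n)) (G : Finset (Fin m)) (z : Fin n → Bool) (v : Fin n) :
    bit (gval I C G (Function.update z v (!z v))) = bit (gval I C G z) + ((if v ∈ C then 1 else 0) + starSum I G v z) := by
  rw [bit_gval_update I hI, bit_not_add, one_mul]

/-- A variable in no AND slot of `G` has partner sum `0`. -/
theorem starSum_eq_zero {G : Finset (Fin m)} {v : Fin n} (hG : ∀ g ∈ G, I.vars g 2 ≠ v ∧ I.vars g 3 ≠ v) (z : Fin n → Bool) :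
    starSum I G v z = 0 := by
  unfold starSum
  exact sum_eq_zero fun g hg => by rw [if_neg (hG g hg).1, if_neg (hG g hg).2, add_zero]

/-- **Updating a PARTNER.**  If `g ∈ G` has AND pair `{v, w}` and no other monomial of `G` has this pair, then updating `x_w` to `c` moves the
partner sum of `v` by `bit c + bit x_w`. -/
theorem starSum_update_partner (hI : I.IsPure xorAndPred) {G : Finset (Fin m)} {g : Fin m} (hg : g ∈ G) {v w : Fin n}
    (hslots : (I.vars g 2 = v ∧ I.vars g 3 = w) ∨ (I.vars g 2 = w ∧ I.vars g 3 = v))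
    (huniq : ∀ g' ∈ G, g' ≠ g → ¬ ((I.vars g' 2 = v ∧ I.vars g' 3 = w) ∨ (I.vars g' 2 = w ∧ I.vars g' 3 = v)))
    (z : Fin n → Bool) (c : Bool) :
    starSum I G v (Function.update z w c) = starSum I G v z + (bit c + bit (z w)) := by
  classical
  have hpq : I.vars g 2 ≠ I.vars g 3 := fun e => absurd (hI.2 g e) (by decide)
  have hvw : v ≠ w := by
    rcases hslots with ⟨h2, h3⟩ | ⟨h2, h3⟩
    · rw [← h2, ← h3]; exact hpq
    · rw [← h2, ← h3]; exact hpq.symm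
  -- pointwise: the term of `g'` moves iff `g'` has the pair `{v, w}`
  have key : ∀ g' ∈ G,
      ((if I.vars g' 2 = v then bit (Function.update z w c (I.vars g' 3)) else 0) +
        (if I.vars g' 3 = v then bit (Function.update z w c (I.vars g' 2)) else 0)) =
      ((if I.vars g' 2 = v then bit (z (I.vars g' 3)) else 0) + (if I.vars g' 3 = v then bit (z (I.vars g' 2)) else 0)) +
        (if g' = g then bit c + bit (z w) else 0) := by
    intro g' hg'
    by_cases he : g' = g
    · subst he
      have h2x : ∀ x : ZMod 2, x + x = 0 := by decide
      rw [if_pos rfl]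
      rcases hslots with ⟨h2, h3⟩ | ⟨h2, h3⟩
      · simp only [h2, h3, Function.update_self, hvw.symm, if_true, if_false, add_zero]
        linear_combination (-1 : ZMod 2) * h2x (bit (z w))
      · simp only [h2, h3, Function.update_self, hvw.symm, if_true, if_false, zero_add]
        linear_combination (-1 : ZMod 2) * h2x (bit (z w))
    · rw [if_neg he, add_zero]
      have hno := huniq g' hg' he
      by_cases h2 : I.vars g' 2 = v
      · have h3 : I.vars g' 3 ≠ w := fun h => hno (Or.inl ⟨h2, h⟩)
        rw [Function.update_of_ne h3]
        by_cases h3' : I.vars g' 3 = v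
        · have h2' : I.vars g' 2 ≠ w := by rw [h2]; exact hvw
          rw [Function.update_of_ne h2']
        · rw [if_neg h3', if_neg h3']
      · rw [if_neg h2, if_neg h2]
        by_cases h3 : I.vars g' 3 = v
        · have h2' : I.vars g' 2 ≠ w := fun h => hno (Or.inr ⟨h, h3⟩)
          rw [Function.update_of_ne h2']
        · rw [if_neg h3, if_neg h3]
  unfold starSum
  rw [sum_congr rfl key, sum_add_distrib, sum_ite_eq' G g, if_pos hg]

end Flip

/-! ## Non-degeneracy of terminal pairs -/
section NonDegenerate

variable {I : LocalMap 4 n m} {r : ℕ} {y : Fin m → Bool} {K : Finset (Fin m)} {w₁ w₂ : Finset (Fin n) × Finset (Fin m) × Bool}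

/-- **NON-DEGENERACY: the slice `Sol(K) ∩ {Γ₁ = b₁}` of a terminal pair is non-empty.**  If `Γ₁` takes both values, `gSat` solves
`K ∧ Γ₁ = b₁` (`#K ≤ r`, monomials off `K`); if it is constant, its value is `b₁` at any (M0) witness, and `Sol(K) ≠ ∅` by expansion. -/
theorem exists_sol_on_target₁ (hI : I.IsPure xorAndPred) (hT : Typed I) (hS : SimpleOverlap I) (hB : BoundaryExpanding r I)
    (ht : Terminal I r y K w₁ w₂) : ∃ x : Fin n → Bool, (∀ j ∈ K, I.eval x j = y j) ∧ gval I w₁.1 w₁.2.1 x = w₁.2.2 := by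
  obtain ⟨hne, -, hKr, hd₁, -, -, -, hM0⟩ := ht
  by_cases hnc : ∃ u u' : Fin n → Bool, gval I w₁.1 w₁.2.1 u ≠ gval I w₁.1 w₁.2.1 u'
  · exact gSat n m r I hI hT hB hS y K w₁.2.1 w₁.1 w₁.2.2 hKr.le hd₁ hnc
  · push Not at hnc
    obtain ⟨f, hf⟩ := hne
    obtain ⟨z, -, hz₁, -⟩ := hM0 f hf
    obtain ⟨x, hx⟩ := feasible_of_boundaryExpanding I hI hB y K hKr.le
    exact ⟨x, hx, (hnc x z).trans hz₁⟩

/-- The same for the second reader. -/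
theorem exists_sol_on_target₂ (hI : I.IsPure xorAndPred) (hT : Typed I) (hS : SimpleOverlap I) (hB : BoundaryExpanding r I)
    (ht : Terminal I r y K w₁ w₂) : ∃ x : Fin n → Bool, (∀ j ∈ K, I.eval x j = y j) ∧ gval I w₂.1 w₂.2.1 x = w₂.2.2 :=
  exists_sol_on_target₁ hI hT hS hB (terminal_swap ht)

end NonDegenerate

/-! ## The poison rule for a foreign variable and the locality theorem -/
section Main

variable {I : LocalMap 4 n m} {r : ℕ} {y : Fin m → Bool} {K : Finset (Fin m)} {w₁ w₂ : Finset (Fin n) × Finset (Fin m) × Bool}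
  {v w : Fin n} {g : Fin m}

/-- **POISON RULE FOR A FOREIGN VARIABLE.**  `(K; Γ₁, Γ₂)` terminal; `v` occurs in no output of `K`, not in `C₁`, in no monomial of `Γ₁`
(any number of monomials of `Γ₂` may pass through `v`, and `v ∈ C₂` is allowed).  Then on `Sol(K) ∩ {Γ₁ = b₁}` the partner sum of `v` in `G₂`
is PINNED: `[v ∈ C₂] + starSum G₂ v ≡ 0`.  (Flipping `x_v` keeps `Sol(K)` and `Γ₁`; by (T3) `Γ₂` misses `b₂` at both points, so it does not move.) -/
theorem starSum_pinned (hI : I.IsPure xorAndPred) (ht : Terminal I r y K w₁ w₂) (hvK : ∀ j ∈ K, v ∉ varSet I j) (hvC₁ : v ∉ w₁.1)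
    (hvG₁ : ∀ g' ∈ w₁.2.1, I.vars g' 2 ≠ v ∧ I.vars g' 3 ≠ v) {x : Fin n → Bool} (hx : ∀ j ∈ K, I.eval x j = y j)
    (hx₁ : gval I w₁.1 w₁.2.1 x = w₁.2.2) : (if v ∈ w₂.1 then (1 : ZMod 2) else 0) + starSum I w₂.2.1 v x = 0 := by
  have hT3 := ht.2.2.2.2.2.2.1
  set x' := Function.update x v (!x v) with hx'
  have hx'K : ∀ j ∈ K, I.eval x' j = y j := solves_update_of_outside hvK hx _
  have hx'₁ : gval I w₁.1 w₁.2.1 x' = w₁.2.2 := by rw [hx', gval_update_of_forall_ne I x hvC₁ hvG₁]; exact hx₁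
  have h₂ : gval I w₂.1 w₂.2.1 x ≠ w₂.2.2 := fun h => hT3 ⟨x, hx, hx₁, h⟩
  have h₂' : gval I w₂.1 w₂.2.1 x' ≠ w₂.2.2 := fun h => hT3 ⟨x', hx'K, hx'₁, h⟩
  have heq : gval I w₂.1 w₂.2.1 x' = gval I w₂.1 w₂.2.1 x := by
    revert h₂ h₂'
    cases gval I w₂.1 w₂.2.1 x' <;> cases gval I w₂.1 w₂.2.1 x <;> cases w₂.2.2 <;> decide
  have hflip := bit_gval_flip I hI w₂.1 w₂.2.1 x v
  rw [← hx', heq] at hflip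
  linear_combination -hflip

/-- **LOCALITY: NO MONOMIAL OF `Γ₂` IS FAR FROM THE `Γ₁`-SIDE.**  `(K; Γ₁, Γ₂)` terminal and non-degenerate (`Sol(K) ∩ {Γ₁ = b₁} ≠ ∅`, automatic
by `exists_sol_on_target₁`); `g ∈ G₂` with AND pair `{v, w}`, BOTH foreign to the `Γ₁`-side (in no output of `K`, not in `C₁`, in no monomial of
`Γ₁`), the pair `{v, w}` carried by no other monomial of `G₂` (simple overlaps).  Contradiction: the partner sum of `v` is pinned on the slice,
but flipping `x_w` stays in the slice and moves it by one. -/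
theorem false_of_far_monomial (hI : I.IsPure xorAndPred) (ht : Terminal I r y K w₁ w₂) (hg : g ∈ w₂.2.1)
    (hslots : (I.vars g 2 = v ∧ I.vars g 3 = w) ∨ (I.vars g 2 = w ∧ I.vars g 3 = v))
    (huniq : ∀ g' ∈ w₂.2.1, g' ≠ g → ¬ ((I.vars g' 2 = v ∧ I.vars g' 3 = w) ∨ (I.vars g' 2 = w ∧ I.vars g' 3 = v)))
    (hvK : ∀ j ∈ K, v ∉ varSet I j) (hvC₁ : v ∉ w₁.1) (hvG₁ : ∀ g' ∈ w₁.2.1, I.vars g' 2 ≠ v ∧ I.vars g' 3 ≠ v)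
    (hwK : ∀ j ∈ K, w ∉ varSet I j) (hwC₁ : w ∉ w₁.1) (hwG₁ : ∀ g' ∈ w₁.2.1, I.vars g' 2 ≠ w ∧ I.vars g' 3 ≠ w)
    (hA : ∃ x : Fin n → Bool, (∀ j ∈ K, I.eval x j = y j) ∧ gval I w₁.1 w₁.2.1 x = w₁.2.2) : False := by
  obtain ⟨x, hx, hx₁⟩ := hA
  set x' := Function.update x w (!x w) with hx'
  have hx'K : ∀ j ∈ K, I.eval x' j = y j := solves_update_of_outside hwK hx _
  have hx'₁ : gval I w₁.1 w₁.2.1 x' = w₁.2.2 := by rw [hx', gval_update_of_forall_ne I x hwC₁ hwG₁]; exact hx₁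
  have h0 := starSum_pinned hI ht hvK hvC₁ hvG₁ hx hx₁
  have h1 := starSum_pinned hI ht hvK hvC₁ hvG₁ hx'K hx'₁
  rw [hx', starSum_update_partner I hI hg hslots huniq x (!x w), bit_not_add] at h1
  have h2 : (1 : ZMod 2) = 0 := by linear_combination h1 - h0
  exact absurd h2 (by decide)

/-- Under simple overlaps the AND pair of `g` is carried by no other monomial. -/
theorem pair_unique (hI : I.IsPure xorAndPred) (hS : SimpleOverlap I) (g : Fin m) {G : Finset (Fin m)} :
    ∀ g' ∈ G, g' ≠ g → ¬ ((I.vars g' 2 = I.vars g 2 ∧ I.vars g' 3 = I.vars g 3) ∨ (I.vars g' 2 = I.vars g 3 ∧ I.vars g' 3 = I.vars g 2)) := by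
  classical
  intro g' _ hne h
  have hpq : I.vars g 2 ≠ I.vars g 3 := fun e => absurd (hI.2 g e) (by decide)
  have hsub : {I.vars g 2, I.vars g 3} ⊆ varSet I g' ∩ varSet I g := by
    intro u hu
    rw [mem_inter]
    rcases mem_insert.1 hu with rfl | hu
    · rcases h with ⟨h2, -⟩ | ⟨-, h3⟩
      · exact ⟨h2 ▸ vars_mem_varSet I g' 2, vars_mem_varSet I g 2⟩
      · exact ⟨h3 ▸ vars_mem_varSet I g' 3, vars_mem_varSet I g 2⟩
    · rw [mem_singleton.1 hu]
      rcases h with ⟨-, h3⟩ | ⟨h2, -⟩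
      · exact ⟨h3 ▸ vars_mem_varSet I g' 3, vars_mem_varSet I g 3⟩
      · exact ⟨h2 ▸ vars_mem_varSet I g' 2, vars_mem_varSet I g 3⟩
  have h2 : ({I.vars g 2, I.vars g 3} : Finset (Fin n)).card = 2 := card_pair hpq
  have := (card_le_card hsub).trans (hS g' g hne)
  omega

/-- **LOCALITY, census form (simple overlaps, non-degeneracy discharged).**  In a terminal pair `(K; Γ₁, Γ₂)` of a pure typed expanding
instance with simple overlaps, every monomial `g ∈ G₂` has an AND variable on the `Γ₁`-side: in an output of `K`, or in `C₁`, or in an AND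
slot of a monomial of `Γ₁`. -/
theorem touches_side₁ (hI : I.IsPure xorAndPred) (hT : Typed I) (hS : SimpleOverlap I) (hB : BoundaryExpanding r I)
    (ht : Terminal I r y K w₁ w₂) (hg : g ∈ w₂.2.1) :
    (∃ j ∈ K, I.vars g 2 ∈ varSet I j ∨ I.vars g 3 ∈ varSet I j) ∨ (I.vars g 2 ∈ w₁.1 ∨ I.vars g 3 ∈ w₁.1) ∨
      ∃ g' ∈ w₁.2.1, I.vars g' 2 = I.vars g 2 ∨ I.vars g' 3 = I.vars g 2 ∨ I.vars g' 2 = I.vars g 3 ∨ I.vars g' 3 = I.vars g 3 := by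
  by_contra h
  push Not at h
  obtain ⟨hK, ⟨h2C, h3C⟩, hG⟩ := h
  exact false_of_far_monomial hI ht hg (Or.inl ⟨rfl, rfl⟩) (pair_unique hI hS g) (fun j hj => (hK j hj).1) h2C
    (fun g' hg' => ⟨(hG g' hg').1, (hG g' hg').2.1⟩) (fun j hj => (hK j hj).2) h3C
    (fun g' hg' => ⟨(hG g' hg').2.2.1, (hG g' hg').2.2.2⟩) (exists_sol_on_target₁ hI hT hS hB ht)

/-- The same with the readers exchanged: every monomial of `Γ₁` touches the `Γ₂`-side. -/
theorem touches_side₂ (hI : I.IsPure xorAndPred) (hT : Typed I) (hS : SimpleOverlap I) (hB : BoundaryExpanding r I)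
    (ht : Terminal I r y K w₁ w₂) (hg : g ∈ w₁.2.1) :
    (∃ j ∈ K, I.vars g 2 ∈ varSet I j ∨ I.vars g 3 ∈ varSet I j) ∨ (I.vars g 2 ∈ w₂.1 ∨ I.vars g 3 ∈ w₂.1) ∨
      ∃ g' ∈ w₂.2.1, I.vars g' 2 = I.vars g 2 ∨ I.vars g' 3 = I.vars g 2 ∨ I.vars g' 2 = I.vars g 3 ∨ I.vars g' 3 = I.vars g 3 :=
  touches_side₁ hI hT hS hB (terminal_swap ht) hg

/-! ## The certificates of the census node -/

/-- **EVERY MONOMIAL OF AN EXACT CERTIFICATE TOUCHES THE PATH-SUM SIDE.**  In the branch-(A) certificates `(K₀; d₁, d₂)` of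
`PstarMenuCriterion.MenuCriterionBound` the first reader `d₁` is the path sum: its linear variables are read by `K₀` (`hread`) and its monomials
are the folds `F₁ = d₁.2.1`.  Hence every monomial `g` of `d₂` (a menu gate of `G` or a fold of `F₂`) has an AND variable in `T(K₀)` or equal to
an AND variable of a fold of `F₁` — for all core sizes, no census. -/
theorem touches_pathSum_side (hI : I.IsPure xorAndPred) (hT : Typed I) (hS : SimpleOverlap I) (hB : BoundaryExpanding r I)
    {K₀ : Finset (Fin m)} {d₁ d₂ : Finset (Fin n) × Finset (Fin m) × Bool} (ht : Terminal I r y K₀ d₁ d₂)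
    (hread : ∀ u ∈ d₁.1, ∃ f ∈ K₀, u ∈ varSet I f) (hg : g ∈ d₂.2.1) :
    (∃ f ∈ K₀, I.vars g 2 ∈ varSet I f ∨ I.vars g 3 ∈ varSet I f) ∨
      ∃ f ∈ d₁.2.1, I.vars f 2 = I.vars g 2 ∨ I.vars f 3 = I.vars g 2 ∨ I.vars f 2 = I.vars g 3 ∨ I.vars f 3 = I.vars g 3 := by
  rcases touches_side₁ hI hT hS hB ht hg with h | h | h
  · exact Or.inl h
  · rcases h with h | h
    · obtain ⟨f, hf, hu⟩ := hread _ h; exact Or.inl ⟨f, hf, Or.inl hu⟩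
    · obtain ⟨f, hf, hu⟩ := hread _ h; exact Or.inl ⟨f, hf, Or.inr hu⟩
  · exact Or.inr h

/-- **Contrapositive, for the census: a menu with a FAR monomial certifies nothing through `(K₀, F₁)`.**  If some `g ∈ d₂.2.1` has both AND
variables outside `T(K₀)` and outside the AND slots of `d₁`'s monomials, `(K₀; d₁, d₂)` is not terminal. -/
theorem not_terminal_of_far (hI : I.IsPure xorAndPred) (hT : Typed I) (hS : SimpleOverlap I) (hB : BoundaryExpanding r I)
    {K₀ : Finset (Fin m)} {d₁ d₂ : Finset (Fin n) × Finset (Fin m) × Bool} (hread : ∀ u ∈ d₁.1, ∃ f ∈ K₀, u ∈ varSet I f)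
    (hg : g ∈ d₂.2.1) (hfar₀ : ∀ f ∈ K₀, I.vars g 2 ∉ varSet I f ∧ I.vars g 3 ∉ varSet I f)
    (hfar₁ : ∀ f ∈ d₁.2.1, I.vars f 2 ≠ I.vars g 2 ∧ I.vars f 3 ≠ I.vars g 2 ∧ I.vars f 2 ≠ I.vars g 3 ∧ I.vars f 3 ≠ I.vars g 3) :
    ¬ Terminal I r y K₀ d₁ d₂ := fun ht => by
  rcases touches_pathSum_side hI hT hS hB ht hread hg with ⟨f, hf, h | h⟩ | ⟨f, hf, h⟩
  · exact (hfar₀ f hf).1 h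
  · exact (hfar₀ f hf).2 h
  · obtain ⟨h1, h2, h3, h4⟩ := hfar₁ f hf
    rcases h with h | h | h | h
    · exact h1 h
    · exact h2 h
    · exact h3 h
    · exact h4 h

end Main

end Summit.PneNP.PneNP.Theorems.PstarMenuLocality
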